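import Literature.NumberTheory.Transcendental.RoyCriterionProofs
import Literature.NumberTheory.Transcendental.LindemannWeierstrassProofs
import HarnessLib

/-!
# Barrier (Schanuel): specialisation collapse of exp-free certificate theses on Roy boxes

`Literature/Barriers/Schanuel/SpecialisationCollapse.lean` — barrier catalogue entry (D-0021) for
the summit `Schanuel` (`Summits/Schanuel/Schanuel/Statement.lean`), definition request
`defn-SpecialisationCollapseBarrier` (planner lens "barrier inversion", output (a)). It is a
PROVED no-go theorem abstracting the mechanism of the two substantive refutations of route
`PolarPhantoms` recorded in `Literature/Barriers/Schanuel/BARRIERS.lean` §2: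

* R1 `Summit.Schanuel.Schanuel.Theorems.PolarPhantomsPolarSchanuel_refuted` (commit `703fb88c`):
  "cheap exact rational certificates on Roy's box at every point of transcendence degree `< n`"
  dies at `y = (π, π²)`, `α = (1 + π, 1 − π)` by the specialisation `π ↦ 0`;
* R2 `Summit.Schanuel.Schanuel.Theorems.PolarPhantomsPhantomsAreTraceless_refuted` (commit
  `7e2444ac`): "phantoms are traceless" dies at `y = (1, e)`, `α = (e, 1)` by `e ↦ 0`.

## The setting (Roy 2001, tree file `Literature/NumberTheory/Transcendental/RoyCriterion.lean`)

For a point `(y, α) ∈ ℂⁿ × (ℂˣ)ⁿ`, parameters `(s₀, s₁, t₀, t₁, u)` in Roy's window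
`RoyAdmissible` and a scale `N`, Roy's box consists of the non-zero `P ∈ ℤ[X₀, X₁]` with
`deg_{X₀} P ≤ N^{t₀}`, `deg_{X₁} P ≤ N^{t₁}`, height `≤ e^N`; the **box values** of `P` are
`v_{k,m} = (D^k P)(∑ⱼ mⱼ yⱼ, ∏ⱼ αⱼ^{mⱼ})` (`k ≤ N^{s₀}`, `max mⱼ ≤ N^{s₁}`, `D = ∂₀ + X₁∂₁`,
`boxValues`). Roy's Conjecture 2 (`RoyCriterion n`, equivalent to Schanuel's conjecture for rank
`n` by the named fact `Roy2001_iff`) says: at a point with `y` `ℚ`-linearly independent and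
`trdeg_ℚ ℚ(y, α) < n` the box values cannot all be `≤ e^{-N^u}` for all large `N`. Roy's
auxiliary construction (§5, 2°; tree theorem `royHypothesis_exp'`, unconditional) shows that at
every EXPONENTIAL point `(y, e^y)` and for every admissible parameter set they ARE all small for
all large `N`. [cite: Roy2001, §1 Conjecture 2 and §5 (2°)]

## The technique class and the barrier (this file)

An **exp-free certificate thesis** (`ExpFreeCertificateThesis n Cert`) asserts, for a predicate
`Cert s₀ s₁ u N v` on box-value functions `v : ℕ → (Fin n → ℕ) → ℂ` ("the values `v` carry a
certificate of non-smallness"), that at EVERY point with `y` `ℚ`-free, `α ∈ (ℂˣ)ⁿ`,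
`trdeg ℚ(y, α) < n`, some admissible parameter set makes every `P` of Roy's box certified for
infinitely many `N`. Route `PolarPhantoms` was of this shape with `Cert = cheapExactCert`
(`∑ c_{k,m} v_{k,m} = z ∈ ℤ ∖ {0}` with rational `c` of `ℓ¹`-cost `< e^{N^u}`); its glue
`PolarGlue` (no certificate at exponential points) then gives Schanuel.

**Specialisation collapse** (`SpecialisationCollapseBarrier`, PROVED as
`specialisationCollapseBarrier_holds`): if the certificate notion
(W2a) `Specialisable` — survives the place `X ↦ 0` of `ℚ[X]`: a certificate for the values
  `V_{k,m}(ω)` (`ω` transcendental, `V_{k,m} ∈ ℚ[X]`) is a certificate for the values `V_{k,m}(0)`,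
(W2b) `RefutesSmall` — certifies no `m`-independent rational vector `(w_k)` with `|w_k| ≤ e^{-N^u}`
  on `k ≤ N^{s₀}`,
then the thesis is FALSE for every `n ≥ 2`. Witness: `ω = π` (transcendental,
`Literature.NumberTheory.Transcendental.transcendental_pi_holds`), `yⱼ = ω^{j+1}`,
`αⱼ = 1 + ω^{j+1}` (`y` `ℚ`-free, `α ∈ (ℂˣ)ⁿ`, `trdeg ℚ(y, α) = 1 < n`); every box value is
`V_{k,m}(ω)` with `V_{k,m}(0) = (D^k P)(0, 1)` INDEPENDENT of `m` — under `X ↦ 0` the whole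
multi-orbit collapses onto the exponential point `(0, e⁰)` — and Roy's auxiliary polynomials at
`y' = 0` make these values `≤ e^{-N^u}` for all large `N` (`not_frequently_cert_of_collapse`, the
abstract form of the inner lemma `noCheap` of R1, valid at every polynomial point `y = Y(ω)`,
`α = A(ω)` with `Y(0) = 0`, `A(0) = 1`).

Instances, all PROVED here: `cheapExactCert` satisfies (W2a) and (W2b)
(`cheapExactCert_specialisable`, `cheapExactCert_refutesSmall`), so
`not_expFreeCertificateThesis_cheapExactCert` is R1 for each `n ≥ 2` in Literature vocabulary.
The only door recorded by the planner, ARCHIMEDEAN certificates `archimedeanCert` (cheap complex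
`c` with `|∑ c v| ≥ 1`), satisfies (W2b) (`archimedeanCert_refutesSmall`) but NOT (W2a)
(`not_specialisable_archimedeanCert`), and its thesis is exactly the `∃`-parameter contrapositive
of Roy's Conjecture 2 (`expFreeCertificateThesis_archimedeanCert_iff`; implied by `RoyCriterion n`,
`expFreeCertificateThesis_archimedeanCert_of_royCriterion`) — i.e. the door leads back to route
`RoyCriterion`, not to an independent line.

## References

* [Roy2001] D. Roy, *An arithmetic criterion for the values of the exponential function*, Acta
  Arith. 97 (2001) 183–194: §1 Conjectures 1–2 and (1); §5, 2° (auxiliary polynomial at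
  exponential points; tree theorem `Literature.NumberTheory.Transcendental.royHypothesis_exp'`).
* Tree: `Summits/Schanuel/Schanuel/Theorems/PolarPhantomsPolarSchanuelRefutation.lean` (R1),
  `…/PolarPhantomsPhantomsAreTracelessRefutation.lean` (R2),
  `Literature/Barriers/Schanuel/BARRIERS.lean` §2 R1–R2 and §6 item 8 ("exp-free 'for every
  point of trdeg `< n`' certificate / exactness statements die by specialisation").
-/

noncomputable section

open MvPolynomial Filter Complex Finset
open scoped Polynomial

namespace Literature.Barriers.Schanuel

open Literature.NumberTheory.Transcendental

/-! ### Roy-box values and certificate predicates -/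

/-- The **box values** of `P ∈ ℤ[X₀, X₁]` at the point `(y, α)`:
`v_{k,m} = (D^k P)(∑ⱼ mⱼ yⱼ, ∏ⱼ αⱼ^{mⱼ})` (the quantities bounded in Roy's Conjecture 2,
`Literature.NumberTheory.Transcendental.RoyHypothesis`). [cite: Roy2001, §1 Conjecture 2] -/
def boxValues {n : ℕ} (y α : Fin n → ℂ) (P : MvPolynomial (Fin 2) ℤ) (k : ℕ) (m : Fin n → ℕ) :
    ℂ :=
  MvPolynomial.aeval ![∑ j, (m j : ℂ) * y j, ∏ j, α j ^ (m j)] (royD^[k] P)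

/-- Unfolding lemma for `boxValues`. [cite: Roy2001, §1 Conjecture 2] -/
theorem boxValues_apply {n : ℕ} (y α : Fin n → ℂ) (P : MvPolynomial (Fin 2) ℤ) (k : ℕ)
    (m : Fin n → ℕ) :
    boxValues y α P k m = MvPolynomial.aeval ![∑ j, (m j : ℂ) * y j, ∏ j, α j ^ (m j)]
      (royD^[k] P) :=
  rfl

/-- The type of **certificate predicates** in rank `n`: `Cert s₀ s₁ u N v` reads "the box-value
function `v : (k, m) ↦ v_{k,m}` carries a certificate at parameters `(s₀, s₁, u)` and scale `N`"
(typically: a certificate that the values are not all `≤ e^{-N^u}` on `k ≤ N^{s₀}`,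
`max mⱼ ≤ N^{s₁}`). [folklore] -/
abbrev CertPred (n : ℕ) : Type :=
  ℝ → ℝ → ℝ → ℕ → (ℕ → (Fin n → ℕ) → ℂ) → Prop

/-- **(W2a) The certificate survives the place `X ↦ 0`.** For every transcendental `ω` and every
family `V_{k,m} ∈ ℚ[X]`, a certificate for the values `V_{k,m}(ω)` is also a certificate for
the rational values `V_{k,m}(0)` (same parameters, same scale). Exact rational certificates have
this property by transcendence of `ω` (`cheapExactCert_specialisable`); archimedean ones do not
(`not_specialisable_archimedeanCert`). [folklore] -/
def Specialisable {n : ℕ} (Cert : CertPred n) : Prop :=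
  ∀ (s₀ s₁ u : ℝ) (N : ℕ) (ω : ℂ), Transcendental ℚ ω → ∀ V : ℕ → (Fin n → ℕ) → ℚ[X],
    Cert s₀ s₁ u N (fun k m => Polynomial.aeval ω (V k m)) →
      Cert s₀ s₁ u N (fun k m => (((V k m).eval 0 : ℚ) : ℂ))

/-- **(W2b) No certificate on Roy-small `m`-independent rational vectors.** If `w : ℕ → ℚ` has
`|w_k| ≤ e^{-N^u}` for `k ≤ N^{s₀}`, the constant-in-`m` value function `(k, m) ↦ w_k` carries no
certificate. [folklore] -/
def RefutesSmall {n : ℕ} (Cert : CertPred n) : Prop :=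
  ∀ (s₀ s₁ u : ℝ) (N : ℕ) (w : ℕ → ℚ),
    (∀ k : ℕ, (k : ℝ) ≤ (N : ℝ) ^ s₀ → |(w k : ℝ)| ≤ Real.exp (-(N : ℝ) ^ u)) →
      ¬ Cert s₀ s₁ u N (fun k _ => ((w k : ℚ) : ℂ))

/-- **The exp-free certificate thesis for `Cert` in rank `n`**: at every point `(y, α)` with `y`
`ℚ`-linearly independent, all `αⱼ ≠ 0` and `trdeg_ℚ ℚ(y, α) < n`, some parameter set in Roy's
window (1) makes EVERY non-zero `P` of Roy's box (`deg_{X₀} P ≤ N^{t₀}`, `deg_{X₁} P ≤ N^{t₁}`,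
height `≤ e^N`) `Cert`-certified, for infinitely many `N`. With `Cert = cheapExactCert n` this is
the rank-`n` slice of the refuted route target `PolarPhantoms.PolarSchanuel` (R1).
[cite: Roy2001, §1 p. 183, criterion (Conj. 2) and window (1)] -/
def ExpFreeCertificateThesis (n : ℕ) (Cert : CertPred n) : Prop :=
  ∀ (y α : Fin n → ℂ), LinearIndependent ℚ y → (∀ j, α j ≠ 0) →
    Algebra.trdeg ℚ ↥(IntermediateField.adjoin ℚ (Set.range y ∪ Set.range α)) < (n : Cardinal) →
    ∃ s₀ s₁ t₀ t₁ u : ℝ, RoyAdmissible s₀ s₁ t₀ t₁ u ∧ ∃ᶠ N : ℕ in atTop,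
      ∀ P : MvPolynomial (Fin 2) ℤ, P ≠ 0 → (P.degreeOf 0 : ℝ) ≤ (N : ℝ) ^ t₀ →
        (P.degreeOf 1 : ℝ) ≤ (N : ℝ) ^ t₁ → (mvPolyHeight P : ℝ) ≤ Real.exp (N : ℝ) →
        Cert s₀ s₁ u N (boxValues y α P)

/-! ### The collapse lemma (abstract form of the inner lemma `noCheap` of R1) -/

/-- A ring map commutes with the evaluation of an integer polynomial in two variables. [folklore] -/
private theorem map_eval₂_intCastRingHom {A B G : Type*} [CommRing A] [CommRing B] [FunLike G A B]
    [RingHomClass G A B] (φ : G) (F : Fin 2 → A) (Q : MvPolynomial (Fin 2) ℤ) :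
    φ (MvPolynomial.eval₂ (Int.castRingHom A) F Q) =
      MvPolynomial.eval₂ (Int.castRingHom B) (fun i => φ (F i)) Q := by
  have h := MvPolynomial.hom_eval₂ Q (Int.castRingHom A) (φ : A →+* B) F
  rw [RingHom.eq_intCast' ((φ : A →+* B).comp (Int.castRingHom A))] at h
  simpa using h

/-- **Specialisation collapse at a polynomial point.** Let `ω` be transcendental and
`yⱼ = Yⱼ(ω)`, `αⱼ = Aⱼ(ω)` with `Yⱼ, Aⱼ ∈ ℚ[X]`, `Yⱼ(0) = 0`, `Aⱼ(0) = 1`. If `Cert` satisfies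
(W2a) and (W2b) then, for EVERY admissible parameter set, it is not the case that for infinitely
many `N` every non-zero `P` of Roy's box is certified at `(y, α)`: the box values are `V_{k,m}(ω)`
for `V_{k,m} ∈ ℚ[X]` with `V_{k,m}(0) = (D^k P)(0, 1)` independent of `m`, and Roy's auxiliary
polynomials at the exponential point `(0, e⁰)` (`royHypothesis_exp'`) have
`|(D^k P_N)(0, 1)| ≤ e^{-N^u}` on `k ≤ N^{s₀}` for all large `N`.
[cite: Roy2001, §5 (2°)] -/
theorem not_frequently_cert_of_collapse {n : ℕ} {Cert : CertPred n} (hW2a : Specialisable Cert)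
    (hW2b : RefutesSmall Cert) {ω : ℂ} (hω : Transcendental ℚ ω) (Y A : Fin n → ℚ[X])
    (hY : ∀ j, (Y j).eval 0 = 0) (hA : ∀ j, (A j).eval 0 = 1) (y α : Fin n → ℂ)
    (hy : ∀ j, y j = Polynomial.aeval ω (Y j)) (hα : ∀ j, α j = Polynomial.aeval ω (A j))
    {s₀ s₁ t₀ t₁ u : ℝ} (hadm : RoyAdmissible s₀ s₁ t₀ t₁ u) :
    ¬ ∃ᶠ N : ℕ in atTop, ∀ P : MvPolynomial (Fin 2) ℤ, P ≠ 0 →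
        (P.degreeOf 0 : ℝ) ≤ (N : ℝ) ^ t₀ → (P.degreeOf 1 : ℝ) ≤ (N : ℝ) ^ t₁ →
        (mvPolyHeight P : ℝ) ≤ Real.exp (N : ℝ) → Cert s₀ s₁ u N (boxValues y α P) := by
  intro hfreq
  have hroy : RoyHypothesis (0 : Fin n → ℂ) (cexp ∘ (0 : Fin n → ℂ)) s₀ s₁ t₀ t₁ u :=
    royHypothesis_exp' (0 : Fin n → ℂ) hadm
  refine Filter.frequently_false (atTop : Filter ℕ) (hfreq.mp (hroy.mono fun N hN hgood => ?_))
  obtain ⟨P, hP0, hd0, hd1, hH, hsmall⟩ := hN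
  have hcert : Cert s₀ s₁ u N (boxValues y α P) := hgood P hP0 hd0 hd1 hH
  -- the generic (polynomial) box point over `ℚ[X]`
  obtain ⟨F, hF⟩ : ∃ F : (Fin n → ℕ) → Fin 2 → ℚ[X],
      ∀ m, F m = ![∑ j, ((m j : ℕ) : ℚ[X]) * Y j, ∏ j, A j ^ (m j)] := ⟨_, fun _ => rfl⟩
  have hpt : ∀ m : Fin n → ℕ, (fun i => Polynomial.aeval ω (F m i)) =
      ![∑ j, ((m j : ℕ) : ℂ) * y j, ∏ j, α j ^ (m j)] := by
    intro m; funext i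
    fin_cases i <;> simp [hF, map_sum, map_prod, hy, hα]
  -- the polynomials `V k m ∈ ℚ[X]` whose value at `ω` is the box value
  obtain ⟨V, hV⟩ : ∃ V : ℕ → (Fin n → ℕ) → ℚ[X],
      ∀ k m, V k m = MvPolynomial.eval₂ (Int.castRingHom ℚ[X]) (F m) (royD^[k] P) :=
    ⟨_, fun _ _ => rfl⟩
  have hval : ∀ (k : ℕ) (m : Fin n → ℕ), boxValues y α P k m = Polynomial.aeval ω (V k m) := by
    intro k m
    rw [boxValues_apply, MvPolynomial.aeval_def, RingHom.eq_intCast' (algebraMap ℤ ℂ), hV,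
      map_eval₂_intCastRingHom, hpt m]
  have hpt0 : ∀ m : Fin n → ℕ, (fun i => (F m i).eval 0) = ![(0 : ℚ), 1] := by
    intro m; funext i
    fin_cases i <;> simp [hF, Polynomial.eval_finsetSum, Polynomial.eval_prod, hY, hA]
  -- the rational numbers `w k = (D^k P)(0, 1)`
  obtain ⟨w, hw⟩ : ∃ w : ℕ → ℚ,
      ∀ k, w k = MvPolynomial.eval₂ (Int.castRingHom ℚ) ![(0 : ℚ), 1] (royD^[k] P) :=
    ⟨_, fun _ => rfl⟩
  have hval0 : ∀ (k : ℕ) (m : Fin n → ℕ), (V k m).eval 0 = w k := by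
    intro k m
    rw [← Polynomial.coe_evalRingHom, hV, map_eval₂_intCastRingHom]
    simp only [Polynomial.coe_evalRingHom]
    rw [hpt0 m, hw]
  have hwC : ∀ k, ((w k : ℚ) : ℂ) = MvPolynomial.aeval ![(0 : ℂ), 1] (royD^[k] P) := by
    intro k
    have h := map_eval₂_intCastRingHom (Rat.castHom ℂ) ![(0 : ℚ), 1] (royD^[k] P)
    have h2 : (fun i => (Rat.castHom ℂ) ((![(0 : ℚ), 1] : Fin 2 → ℚ) i)) = ![(0 : ℂ), 1] := by
      funext i; fin_cases i <;> simp
    rw [h2, Rat.coe_castHom, ← hw] at h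
    rw [MvPolynomial.aeval_def, RingHom.eq_intCast' (algebraMap ℤ ℂ), ← h]
  -- smallness of `w k` on `k ≤ N^{s₀}`, from Roy's auxiliary polynomial at the collapsed point
  have hsmallw : ∀ k : ℕ, (k : ℝ) ≤ (N : ℝ) ^ s₀ → |(w k : ℝ)| ≤ Real.exp (-(N : ℝ) ^ u) := by
    intro k hk
    have h := hsmall k (fun _ => 0) hk (fun j => by simp only [Nat.cast_zero]; positivity)
    have hp : (![∑ j, (((fun _ => 0 : Fin n → ℕ) j : ℕ) : ℂ) * (0 : Fin n → ℂ) j,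
        ∏ j, (cexp ∘ (0 : Fin n → ℂ)) j ^ ((fun _ => 0 : Fin n → ℕ) j)] : Fin 2 → ℂ) =
        ![(0 : ℂ), 1] := by
      simp
    rw [hp, ← hwC k, Complex.norm_ratCast] at h
    exact h
  -- (W2a): move the certificate to the specialised values, which are `w k`, independent of `m`
  have hfun : boxValues y α P = fun k m => Polynomial.aeval ω (V k m) := by
    funext k m; exact hval k m
  have hcert0 : Cert s₀ s₁ u N (fun k m => (((V k m).eval 0 : ℚ) : ℂ)) :=
    hW2a s₀ s₁ u N ω hω V (hfun ▸ hcert)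
  have hfun0 :
      (fun k m => (((V k m).eval 0 : ℚ) : ℂ)) = fun k (_ : Fin n → ℕ) => ((w k : ℚ) : ℂ) := by
    funext k m; rw [hval0 k m]
  rw [hfun0] at hcert0
  -- (W2b): no certificate on Roy-small `m`-independent vectors
  exact hW2b s₀ s₁ u N w hsmallw hcert0

/-! ### The witness point `yⱼ = ω^{j+1}`, `αⱼ = 1 + ω^{j+1}` -/

/-- Distinct positive powers of a transcendental number are `ℚ`-linearly independent. [folklore] -/
theorem linearIndependent_pow_succ_of_transcendental {ω : ℂ} (hω : Transcendental ℚ ω) (n : ℕ) :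
    LinearIndependent ℚ (fun j : Fin n => ω ^ ((j : ℕ) + 1)) := by
  have hinj : Function.Injective (Polynomial.aeval ω : ℚ[X] →ₐ[ℚ] ℂ) :=
    transcendental_iff_injective.mp hω
  rw [Fintype.linearIndependent_iff]
  intro g hg i
  -- the polynomial `∑ⱼ gⱼ X^{j+1}` vanishes at `ω`, hence is zero
  set p : ℚ[X] := ∑ j : Fin n, Polynomial.monomial ((j : ℕ) + 1) (g j) with hp
  have hpω : Polynomial.aeval ω p = ∑ j : Fin n, g j • ω ^ ((j : ℕ) + 1) := by
    simp only [hp, map_sum, Polynomial.aeval_monomial, Algebra.smul_def]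
  have hp0 : p = 0 := hinj (by rw [hpω, hg, map_zero])
  have hcoeff : p.coeff ((i : ℕ) + 1) = g i := by
    simp only [hp, Polynomial.finsetSum_coeff, Polynomial.coeff_monomial]
    rw [Finset.sum_eq_single i]
    · simp
    · intro j _ hji
      rw [if_neg]
      intro h
      exact hji (Fin.ext (by omega))
    · intro h; exact absurd (Finset.mem_univ i) h
  rw [← hcoeff, hp0, Polynomial.coeff_zero]

/-- `1 + ω^k ≠ 0` for transcendental `ω` and `k ≥ 1`. [folklore] -/
theorem one_add_pow_ne_zero_of_transcendental {ω : ℂ} (hω : Transcendental ℚ ω) {k : ℕ}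
    (hk : 0 < k) : 1 + ω ^ k ≠ 0 := by
  intro h
  apply hω
  refine ⟨Polynomial.X ^ k + Polynomial.C 1, Polynomial.X_pow_add_C_ne_zero hk 1, ?_⟩
  simp only [map_add, map_pow, Polynomial.aeval_X, map_one]
  rw [add_comm]; exact h

/-- `trdeg_ℚ ℚ(ω) ≤ 1` for every `ω ∈ ℂ`. [folklore] -/
private theorem trdeg_adjoin_simple_le_one (ω : ℂ) :
    Algebra.trdeg ℚ ↥(IntermediateField.adjoin ℚ ({ω} : Set ℂ)) ≤ 1 := by
  classical
  open scoped IntermediateField.algebraAdjoinAdjoin in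
  let Lt : IntermediateField ℚ ℂ := IntermediateField.adjoin ℚ ({ω} : Set ℂ)
  let t' : Lt := ⟨ω, IntermediateField.mem_adjoin_simple_self ℚ ω⟩
  have hmap : Subalgebra.map Lt.val (Algebra.adjoin ℚ ({t'} : Set Lt)) =
      Algebra.adjoin ℚ ({ω} : Set ℂ) := by
    rw [AlgHom.map_adjoin, Set.image_singleton]
    rfl
  let e : Algebra.adjoin ℚ ({t'} : Set Lt) ≃ₐ[ℚ] Algebra.adjoin ℚ ({ω} : Set ℂ) :=
    (Subalgebra.equivMapOfInjective _ Lt.val Subtype.val_injective).trans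
      (Subalgebra.equivOfEq _ _ hmap)
  haveI : Algebra.IsAlgebraic (Algebra.adjoin ℚ ({t'} : Set Lt)) Lt := by
    refine ⟨fun y => ?_⟩
    have hy : IsAlgebraic (Algebra.adjoin ℚ ({ω} : Set ℂ)) (y : Lt) :=
      Algebra.IsAlgebraic.isAlgebraic y
    refine IsAlgebraic.of_ringHom_of_comp_eq (e : _ →+* _) (RingHom.id Lt) (by simpa using hy)
      e.surjective Function.injective_id ?_
    ext x
    rfl
  have h := Algebra.IsAlgebraic.trdeg_le_cardinalMk (R := ℚ) ({t'} : Set Lt)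
  simpa using h

/-- The witness point has `trdeg_ℚ ℚ(y, α) ≤ 1` (indeed `ℚ(y, α) ⊆ ℚ(ω)`). [folklore] -/
theorem trdeg_adjoin_witness_le_one (ω : ℂ) (n : ℕ) :
    Algebra.trdeg ℚ ↥(IntermediateField.adjoin ℚ
      (Set.range (fun j : Fin n => ω ^ ((j : ℕ) + 1)) ∪
        Set.range (fun j : Fin n => 1 + ω ^ ((j : ℕ) + 1)))) ≤ 1 := by
  have hωK : ω ∈ IntermediateField.adjoin ℚ ({ω} : Set ℂ) :=
    IntermediateField.mem_adjoin_simple_self ℚ ω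
  have hle : IntermediateField.adjoin ℚ
      (Set.range (fun j : Fin n => ω ^ ((j : ℕ) + 1)) ∪
        Set.range (fun j : Fin n => 1 + ω ^ ((j : ℕ) + 1))) ≤
      IntermediateField.adjoin ℚ ({ω} : Set ℂ) := by
    rw [IntermediateField.adjoin_le_iff]
    rintro x (⟨j, rfl⟩ | ⟨j, rfl⟩)
    · exact pow_mem hωK _
    · exact add_mem (one_mem _) (pow_mem hωK _)
  exact (trdeg_le_of_injective (IntermediateField.inclusion hle)
    (IntermediateField.inclusion_injective hle)).trans (trdeg_adjoin_simple_le_one ω)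

/-! ### The barrier theorem -/

/-- **Specialisation collapse (the barrier, unbundled).** For `n ≥ 2`, no certificate notion
satisfying (W2a) `Specialisable` and (W2b) `RefutesSmall` has a true exp-free certificate
thesis: the thesis fails at the point `yⱼ = π^{j+1}`, `αⱼ = 1 + π^{j+1}` (`y` `ℚ`-free by
transcendence of `π`, `α ∈ (ℂˣ)ⁿ`, `trdeg ℚ(y, α) ≤ 1 < n`), for EVERY admissible parameter set,
by `not_frequently_cert_of_collapse`. [cite: Roy2001, §5 (2°)] -/
theorem not_expFreeCertificateThesis_of_specialisable_of_refutesSmall {n : ℕ} (hn : 2 ≤ n)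
    {Cert : CertPred n} (hW2a : Specialisable Cert) (hW2b : RefutesSmall Cert) :
    ¬ ExpFreeCertificateThesis n Cert := by
  intro hX
  have hω : Transcendental ℚ ((Real.pi : ℝ) : ℂ) :=
    (transcendental_algebraMap_iff (R := ℚ) (A := ℂ) Complex.ofReal_injective).mpr
      transcendental_pi_holds
  have h1n : (1 : Cardinal) < (n : Cardinal) := by
    exact_mod_cast (Nat.lt_of_succ_le hn : (1 : ℕ) < n)
  obtain ⟨s₀, s₁, t₀, t₁, u, hadm, hfreq⟩ := hX
    (fun j : Fin n => ((Real.pi : ℝ) : ℂ) ^ ((j : ℕ) + 1))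
    (fun j : Fin n => 1 + ((Real.pi : ℝ) : ℂ) ^ ((j : ℕ) + 1))
    (linearIndependent_pow_succ_of_transcendental hω n)
    (fun j => one_add_pow_ne_zero_of_transcendental hω (Nat.succ_pos j))
    ((trdeg_adjoin_witness_le_one _ n).trans_lt h1n)
  exact not_frequently_cert_of_collapse hW2a hW2b hω (fun j => Polynomial.X ^ ((j : ℕ) + 1))
    (fun j => 1 + Polynomial.X ^ ((j : ℕ) + 1)) (fun j => by simp) (fun j => by simp) _ _
    (fun j => by simp) (fun j => by simp) hadm hfreq

/-! ### Instance R1: cheap exact rational certificates (route `PolarPhantoms`) -/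

/-- **Cheap exact certificates** (the certificate notion of the refuted route target
`PolarPhantoms.PolarSchanuel`, R1): rational coefficients `c_{k,m}` (`k ≤ N^{s₀}`,
`m ∈ [0, N^{s₁}]ⁿ`) of `ℓ¹`-cost `< e^{N^u}` with `∑ c_{k,m} v_{k,m} = z ∈ ℤ ∖ {0}`.
`ExpFreeCertificateThesis n (cheapExactCert n)` is, definitionally, the rank-`n` slice of that
route target. [folklore] -/
def cheapExactCert (n : ℕ) : CertPred n := fun s₀ s₁ u N v =>
  ∃ c : ℕ → (Fin n → ℕ) → ℚ,
    (∑ k ∈ range (⌊(N : ℝ) ^ s₀⌋₊ + 1),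
      ∑ m ∈ Fintype.piFinset (fun _ : Fin n => range (⌊(N : ℝ) ^ s₁⌋₊ + 1)), |(c k m : ℝ)|) <
        Real.exp ((N : ℝ) ^ u) ∧
    ∃ z : ℤ, z ≠ 0 ∧
      (∑ k ∈ range (⌊(N : ℝ) ^ s₀⌋₊ + 1),
        ∑ m ∈ Fintype.piFinset (fun _ : Fin n => range (⌊(N : ℝ) ^ s₁⌋₊ + 1)),
          (c k m : ℂ) * v k m) = (z : ℂ)

/-- (W2a) for cheap exact certificates: a rational certificate `∑ c_{k,m} V_{k,m}(ω) = z` is, by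
transcendence of `ω`, the polynomial identity `∑ c_{k,m} V_{k,m} = z` in `ℚ[X]`, which at
`X = 0` reads `∑ c_{k,m} V_{k,m}(0) = z` — same coefficients, same cost. [folklore] -/
theorem cheapExactCert_specialisable (n : ℕ) : Specialisable (cheapExactCert n) := by
  intro s₀ s₁ u N ω hω V hcert
  obtain ⟨c, hcost, z, hz, hsum⟩ := hcert
  refine ⟨c, hcost, z, hz, ?_⟩
  have hinj : Function.Injective (Polynomial.aeval ω : ℚ[X] →ₐ[ℚ] ℂ) :=
    transcendental_iff_injective.mp hω
  set Ks := range (⌊(N : ℝ) ^ s₀⌋₊ + 1) with hKs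
  set Ms := Fintype.piFinset (fun _ : Fin n => range (⌊(N : ℝ) ^ s₁⌋₊ + 1)) with hMs
  obtain ⟨W, hW⟩ : ∃ W : ℚ[X], W = ∑ k ∈ Ks, ∑ m ∈ Ms, c k m • V k m := ⟨_, rfl⟩
  have hWω : Polynomial.aeval ω W = (z : ℂ) := by
    rw [← hsum, hW, map_sum]
    refine Finset.sum_congr rfl fun k _ => ?_
    rw [map_sum]
    refine Finset.sum_congr rfl fun m _ => ?_
    rw [map_smul, Algebra.smul_def, eq_ratCast]
  have hWC : W = Polynomial.C (z : ℚ) := by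
    apply hinj
    rw [hWω, Polynomial.aeval_C, eq_ratCast, Rat.cast_intCast]
  have hz_eq : ∑ k ∈ Ks, ∑ m ∈ Ms, c k m * (V k m).eval 0 = (z : ℚ) := by
    have h := congrArg (Polynomial.eval (0 : ℚ)) hWC
    rw [Polynomial.eval_C] at h
    rw [← h, hW, Polynomial.eval_finsetSum]
    refine Finset.sum_congr rfl fun k _ => ?_
    rw [Polynomial.eval_finsetSum]
    refine Finset.sum_congr rfl fun m _ => ?_
    rw [Polynomial.eval_smul, smul_eq_mul]
  beta_reduce
  exact_mod_cast hz_eq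

/-- (W2b) for cheap exact certificates: `|z| ≤ ‖c‖₁ e^{-N^u} < 1` forces `z = 0`. [folklore] -/
theorem cheapExactCert_refutesSmall (n : ℕ) : RefutesSmall (cheapExactCert n) := by
  intro s₀ s₁ u N w hw hcert
  obtain ⟨c, hcost, z, hz, hsum⟩ := hcert
  beta_reduce at hsum
  have hq : (∑ k ∈ range (⌊(N : ℝ) ^ s₀⌋₊ + 1),
      ∑ m ∈ Fintype.piFinset (fun _ : Fin n => range (⌊(N : ℝ) ^ s₁⌋₊ + 1)),
        c k m * w k : ℚ) = (z : ℚ) := by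
    exact_mod_cast hsum
  have h1 : (z : ℝ) = ∑ k ∈ range (⌊(N : ℝ) ^ s₀⌋₊ + 1),
      ∑ m ∈ Fintype.piFinset (fun _ : Fin n => range (⌊(N : ℝ) ^ s₁⌋₊ + 1)),
        (c k m : ℝ) * (w k : ℝ) := by
    have h2 := congrArg (fun q : ℚ => (q : ℝ)) hq
    push_cast at h2
    exact h2.symm
  have hzR : |(z : ℝ)| < 1 := by
    rw [h1]
    calc |∑ k ∈ range (⌊(N : ℝ) ^ s₀⌋₊ + 1),
          ∑ m ∈ Fintype.piFinset (fun _ : Fin n => range (⌊(N : ℝ) ^ s₁⌋₊ + 1)),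
            (c k m : ℝ) * (w k : ℝ)|
        ≤ ∑ k ∈ range (⌊(N : ℝ) ^ s₀⌋₊ + 1),
          ∑ m ∈ Fintype.piFinset (fun _ : Fin n => range (⌊(N : ℝ) ^ s₁⌋₊ + 1)),
            |(c k m : ℝ)| * Real.exp (-(N : ℝ) ^ u) := by
          refine (Finset.abs_sum_le_sum_abs _ _).trans (Finset.sum_le_sum fun k hk => ?_)
          refine (Finset.abs_sum_le_sum_abs _ _).trans (Finset.sum_le_sum fun m _ => ?_)
          rw [abs_mul]
          have hk' : (k : ℝ) ≤ (N : ℝ) ^ s₀ :=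
            (Nat.le_floor_iff (by positivity)).mp (Nat.lt_succ_iff.mp (Finset.mem_range.mp hk))
          exact mul_le_mul_of_nonneg_left (hw k hk') (abs_nonneg _)
      _ = (∑ k ∈ range (⌊(N : ℝ) ^ s₀⌋₊ + 1),
          ∑ m ∈ Fintype.piFinset (fun _ : Fin n => range (⌊(N : ℝ) ^ s₁⌋₊ + 1)),
            |(c k m : ℝ)|) * Real.exp (-(N : ℝ) ^ u) := by
          rw [Finset.sum_mul]
          refine Finset.sum_congr rfl fun k _ => ?_
          rw [Finset.sum_mul]
      _ < Real.exp ((N : ℝ) ^ u) * Real.exp (-(N : ℝ) ^ u) :=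
          mul_lt_mul_of_pos_right hcost (Real.exp_pos _)
      _ = 1 := by rw [← Real.exp_add, add_neg_cancel, Real.exp_zero]
  have hz1 : (1 : ℝ) ≤ |(z : ℝ)| := by
    rw [← Int.cast_abs]
    exact_mod_cast Int.one_le_abs hz
  linarith

/-- **R1 in Literature vocabulary**: for every `n ≥ 2` the exp-free thesis of cheap exact
certificates (the rank-`n` slice of `PolarPhantoms.PolarSchanuel`, refuted in the tree by
`Summit.Schanuel.Schanuel.Theorems.PolarPhantomsPolarSchanuel_refuted`) is false. [folklore] -/
theorem not_expFreeCertificateThesis_cheapExactCert {n : ℕ} (hn : 2 ≤ n) :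
    ¬ ExpFreeCertificateThesis n (cheapExactCert n) :=
  not_expFreeCertificateThesis_of_specialisable_of_refutesSmall hn (cheapExactCert_specialisable n)
    (cheapExactCert_refutesSmall n)

/-! ### The door: archimedean certificates (outside the class; equal to Roy's criterion) -/

/-- **Archimedean certificates**: complex coefficients `c_{k,m}` of `ℓ¹`-cost `< e^{N^u}` with
`|∑ c_{k,m} v_{k,m}| ≥ 1`. They certify exactly "not all `|v_{k,m}| ≤ e^{-N^u}` on Roy's range"
(`archimedeanCert_iff_not_small`). [folklore] -/
def archimedeanCert (n : ℕ) : CertPred n := fun s₀ s₁ u N v =>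
  ∃ c : ℕ → (Fin n → ℕ) → ℂ,
    (∑ k ∈ range (⌊(N : ℝ) ^ s₀⌋₊ + 1),
      ∑ m ∈ Fintype.piFinset (fun _ : Fin n => range (⌊(N : ℝ) ^ s₁⌋₊ + 1)), ‖c k m‖) <
        Real.exp ((N : ℝ) ^ u) ∧
    1 ≤ ‖∑ k ∈ range (⌊(N : ℝ) ^ s₀⌋₊ + 1),
      ∑ m ∈ Fintype.piFinset (fun _ : Fin n => range (⌊(N : ℝ) ^ s₁⌋₊ + 1)), c k m * v k m‖

/-- A double sum of a function supported at one index pair of the range is its value there.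
[folklore] -/
private theorem sum_sum_eq_single {M : Type*} [AddCommMonoid M] {n : ℕ} {Ks : Finset ℕ}
    {Ms : Finset (Fin n → ℕ)} {k₀ : ℕ} {m₀ : Fin n → ℕ} (hk : k₀ ∈ Ks) (hm : m₀ ∈ Ms)
    (g : ℕ → (Fin n → ℕ) → M) (hg : ∀ k m, ¬ (k = k₀ ∧ m = m₀) → g k m = 0) :
    (∑ k ∈ Ks, ∑ m ∈ Ms, g k m) = g k₀ m₀ := by
  rw [Finset.sum_eq_single_of_mem k₀ hk]
  · rw [Finset.sum_eq_single_of_mem m₀ hm]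
    intro m _ hmne
    exact hg k₀ m (fun h => hmne h.2)
  · intro k _ hkne
    exact Finset.sum_eq_zero fun m _ => hg k m (fun h => hkne h.1)

/-- Membership in Roy's `k`-range `k ≤ N^{s₀}` as a `Finset.range`. [folklore] -/
private theorem mem_range_floor_iff {N k : ℕ} {s : ℝ} :
    k ∈ range (⌊(N : ℝ) ^ s⌋₊ + 1) ↔ (k : ℝ) ≤ (N : ℝ) ^ s := by
  rw [Finset.mem_range, Nat.lt_succ_iff, Nat.le_floor_iff (by positivity)]

/-- Archimedean certificates certify exactly the failure of Roy-smallness on the range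
`k ≤ N^{s₀}`, `max mⱼ ≤ N^{s₁}`. [folklore] -/
theorem archimedeanCert_iff_not_small (n : ℕ) (s₀ s₁ u : ℝ) (N : ℕ)
    (v : ℕ → (Fin n → ℕ) → ℂ) :
    archimedeanCert n s₀ s₁ u N v ↔
      ¬ ∀ (k : ℕ) (m : Fin n → ℕ), (k : ℝ) ≤ (N : ℝ) ^ s₀ → (∀ j, (m j : ℝ) ≤ (N : ℝ) ^ s₁) →
        ‖v k m‖ ≤ Real.exp (-(N : ℝ) ^ u) := by
  constructor
  · rintro ⟨c, hcost, hbig⟩ hsmall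
    have hlt : ‖∑ k ∈ range (⌊(N : ℝ) ^ s₀⌋₊ + 1),
        ∑ m ∈ Fintype.piFinset (fun _ : Fin n => range (⌊(N : ℝ) ^ s₁⌋₊ + 1)), c k m * v k m‖ <
        1 := by
      calc ‖∑ k ∈ range (⌊(N : ℝ) ^ s₀⌋₊ + 1),
            ∑ m ∈ Fintype.piFinset (fun _ : Fin n => range (⌊(N : ℝ) ^ s₁⌋₊ + 1)), c k m * v k m‖
          ≤ ∑ k ∈ range (⌊(N : ℝ) ^ s₀⌋₊ + 1),
            ∑ m ∈ Fintype.piFinset (fun _ : Fin n => range (⌊(N : ℝ) ^ s₁⌋₊ + 1)),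
              ‖c k m‖ * Real.exp (-(N : ℝ) ^ u) := by
            refine (norm_sum_le _ _).trans (Finset.sum_le_sum fun k hk => ?_)
            refine (norm_sum_le _ _).trans (Finset.sum_le_sum fun m hm => ?_)
            rw [norm_mul]
            refine mul_le_mul_of_nonneg_left (hsmall k m (mem_range_floor_iff.mp hk) fun j => ?_)
              (norm_nonneg _)
            exact mem_range_floor_iff.mp (Fintype.mem_piFinset.mp hm j)
        _ = (∑ k ∈ range (⌊(N : ℝ) ^ s₀⌋₊ + 1),
            ∑ m ∈ Fintype.piFinset (fun _ : Fin n => range (⌊(N : ℝ) ^ s₁⌋₊ + 1)),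
              ‖c k m‖) * Real.exp (-(N : ℝ) ^ u) := by
            rw [Finset.sum_mul]
            refine Finset.sum_congr rfl fun k _ => ?_
            rw [Finset.sum_mul]
        _ < Real.exp ((N : ℝ) ^ u) * Real.exp (-(N : ℝ) ^ u) :=
            mul_lt_mul_of_pos_right hcost (Real.exp_pos _)
        _ = 1 := by rw [← Real.exp_add, add_neg_cancel, Real.exp_zero]
    linarith
  · intro h
    push Not at h
    obtain ⟨k₀, m₀, hk₀, hm₀, hv⟩ := h
    have hv0 : v k₀ m₀ ≠ 0 := by
      intro h0
      rw [h0, norm_zero] at hv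
      exact absurd hv (not_lt.mpr (Real.exp_nonneg _))
    have hkmem : k₀ ∈ range (⌊(N : ℝ) ^ s₀⌋₊ + 1) := mem_range_floor_iff.mpr hk₀
    have hmmem : m₀ ∈ Fintype.piFinset (fun _ : Fin n => range (⌊(N : ℝ) ^ s₁⌋₊ + 1)) :=
      Fintype.mem_piFinset.mpr fun j => mem_range_floor_iff.mpr (hm₀ j)
    refine ⟨fun k m => if k = k₀ ∧ m = m₀ then (v k₀ m₀)⁻¹ else 0, ?_, ?_⟩
    · calc (∑ k ∈ range (⌊(N : ℝ) ^ s₀⌋₊ + 1),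
            ∑ m ∈ Fintype.piFinset (fun _ : Fin n => range (⌊(N : ℝ) ^ s₁⌋₊ + 1)),
              ‖(if k = k₀ ∧ m = m₀ then (v k₀ m₀)⁻¹ else 0 : ℂ)‖)
          = ‖(if k₀ = k₀ ∧ m₀ = m₀ then (v k₀ m₀)⁻¹ else 0 : ℂ)‖ :=
            sum_sum_eq_single hkmem hmmem
              (fun k m => ‖(if k = k₀ ∧ m = m₀ then (v k₀ m₀)⁻¹ else 0 : ℂ)‖)
              (fun k m hkm => by simp [hkm])
        _ = ‖v k₀ m₀‖⁻¹ := by rw [if_pos ⟨rfl, rfl⟩, norm_inv]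
        _ < Real.exp ((N : ℝ) ^ u) :=
            inv_lt_of_inv_lt₀ (Real.exp_pos _) (by rwa [← Real.exp_neg])
    · calc (1 : ℝ) = ‖(if k₀ = k₀ ∧ m₀ = m₀ then (v k₀ m₀)⁻¹ else 0 : ℂ) * v k₀ m₀‖ := by
            rw [if_pos ⟨rfl, rfl⟩, inv_mul_cancel₀ hv0, norm_one]
        _ = ‖∑ k ∈ range (⌊(N : ℝ) ^ s₀⌋₊ + 1),
            ∑ m ∈ Fintype.piFinset (fun _ : Fin n => range (⌊(N : ℝ) ^ s₁⌋₊ + 1)),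
              (if k = k₀ ∧ m = m₀ then (v k₀ m₀)⁻¹ else 0 : ℂ) * v k m‖ := by
            rw [sum_sum_eq_single hkmem hmmem
              (fun k m => (if k = k₀ ∧ m = m₀ then (v k₀ m₀)⁻¹ else 0 : ℂ) * v k m)
              (fun k m hkm => by simp [hkm])]
      exact le_rfl

/-- (W2b) for archimedean certificates: `|∑ c w| ≤ ‖c‖₁ e^{-N^u} < 1`. [folklore] -/
theorem archimedeanCert_refutesSmall (n : ℕ) : RefutesSmall (archimedeanCert n) := by
  intro s₀ s₁ u N w hw
  rw [archimedeanCert_iff_not_small, not_not]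
  intro k m hk _
  rw [Complex.norm_ratCast]
  exact hw k hk

/-- **Archimedean certificates are NOT specialisable** — the door is outside the technique
class: with `N = 1`, `V_{k,m} = X` and `ω = π` the values `V_{k,m}(π) = π` carry the cheap
certificate `c = 𝟙_{(0,0)}` (`|π| ≥ 1`), while the specialised values `V_{k,m}(0) = 0` carry
none. [folklore] -/
theorem not_specialisable_archimedeanCert (n : ℕ) : ¬ Specialisable (archimedeanCert n) := by
  intro h
  have hω : Transcendental ℚ ((Real.pi : ℝ) : ℂ) :=
    (transcendental_algebraMap_iff (R := ℚ) (A := ℂ) Complex.ofReal_injective).mpr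
      transcendental_pi_holds
  have hcert : archimedeanCert n 0 0 1 1
      (fun _ _ => Polynomial.aeval ((Real.pi : ℝ) : ℂ) (Polynomial.X : ℚ[X])) := by
    rw [archimedeanCert_iff_not_small]
    intro hsmall
    have h00 := hsmall 0 (fun _ => 0) (by simp) (fun _ => by simp)
    rw [Polynomial.aeval_X, Complex.norm_real, Real.norm_eq_abs, abs_of_pos Real.pi_pos,
      Nat.cast_one, Real.one_rpow] at h00
    have h3 := Real.pi_gt_three
    have he : Real.exp (-(1 : ℝ)) < 1 := Real.exp_lt_one_iff.mpr (by norm_num)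
    linarith
  have h0 := h 0 0 1 1 _ hω (fun _ _ => Polynomial.X) hcert
  rw [archimedeanCert_iff_not_small] at h0
  apply h0
  intro k m _ _
  rw [Polynomial.eval_X, Rat.cast_zero, norm_zero]
  exact Real.exp_nonneg _

/-- **The archimedean thesis is the `∃`-parameter contrapositive of Roy's Conjecture 2**: for
every point in scope, some admissible parameter set violates `RoyHypothesis` (Roy: Conjecture 2
for one admissible parameter set already implies Schanuel's conjecture for that `n`).
[cite: Roy2001, §1 Conjecture 2 and the remark after (1)] -/
theorem expFreeCertificateThesis_archimedeanCert_iff (n : ℕ) :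
    ExpFreeCertificateThesis n (archimedeanCert n) ↔
      ∀ (y α : Fin n → ℂ), LinearIndependent ℚ y → (∀ j, α j ≠ 0) →
        Algebra.trdeg ℚ ↥(IntermediateField.adjoin ℚ (Set.range y ∪ Set.range α)) <
          (n : Cardinal) →
        ∃ s₀ s₁ t₀ t₁ u : ℝ, RoyAdmissible s₀ s₁ t₀ t₁ u ∧ ¬ RoyHypothesis y α s₀ s₁ t₀ t₁ u := by
  have key : ∀ (y α : Fin n → ℂ) (s₀ s₁ t₀ t₁ u : ℝ),
      (∃ᶠ N : ℕ in atTop, ∀ P : MvPolynomial (Fin 2) ℤ, P ≠ 0 →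
        (P.degreeOf 0 : ℝ) ≤ (N : ℝ) ^ t₀ → (P.degreeOf 1 : ℝ) ≤ (N : ℝ) ^ t₁ →
        (mvPolyHeight P : ℝ) ≤ Real.exp (N : ℝ) →
          archimedeanCert n s₀ s₁ u N (boxValues y α P)) ↔
      ¬ RoyHypothesis y α s₀ s₁ t₀ t₁ u := by
    intro y α s₀ s₁ t₀ t₁ u
    rw [RoyHypothesis, Filter.not_eventually]
    refine Filter.frequently_congr (Filter.Eventually.of_forall fun N => ?_)
    simp only [not_exists, not_and]
    refine forall_congr' fun P => forall_congr' fun _ => forall_congr' fun _ =>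
      forall_congr' fun _ => forall_congr' fun _ => ?_
    exact archimedeanCert_iff_not_small n s₀ s₁ u N (boxValues y α P)
  refine forall_congr' fun y => forall_congr' fun α => forall_congr' fun _ =>
    forall_congr' fun _ => forall_congr' fun _ => ?_
  exact exists_congr fun s₀ => exists_congr fun s₁ => exists_congr fun t₀ =>
    exists_congr fun t₁ => exists_congr fun u => and_congr Iff.rfl (key y α s₀ s₁ t₀ t₁ u)

/-- Roy's Conjecture 2 for rank `n` (`RoyCriterion n`, `∀`-parameter form) implies the
archimedean thesis: the door leads back to route `RoyCriterion`. [cite: Roy2001, §1 Conjecture 2] -/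
theorem expFreeCertificateThesis_archimedeanCert_of_royCriterion {n : ℕ} (h : RoyCriterion n) :
    ExpFreeCertificateThesis n (archimedeanCert n) := by
  rw [expFreeCertificateThesis_archimedeanCert_iff]
  intro y α hy hα htr
  refine ⟨_, _, _, _, _, royAdmissible_example, fun hroy => ?_⟩
  exact not_le.mpr htr (h y α hy hα _ _ _ _ _ royAdmissible_example hroy)

/-! ### The catalogue declaration -/

/-- **Barrier (catalogue declaration): specialisation collapse.** For every `n ≥ 2` and every
certificate predicate `Cert` on Roy box-value functions which (W2a) survives the place `X ↦ 0`
(`Specialisable`) and (W2b) certifies no Roy-small `m`-independent rational vector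
(`RefutesSmall`), the exp-free certificate thesis `ExpFreeCertificateThesis n Cert` ("at every
point with `y` `ℚ`-free, `α ∈ (ℂˣ)ⁿ`, `trdeg ℚ(y, α) < n`, some admissible parameter set makes
every `P` of Roy's box certified for infinitely many `N`") is FALSE. PROVED
(`specialisationCollapseBarrier_holds`).

BARRIER (D-0021).
- technique_class: transference polar-body exact-certificate cheap-rational-certificate tracelessness exp-free-roy-box-statements transcendence-criterion-at-points roy-box-exactness
- explicit_class: pairs `(n, Cert)` with `n ≥ 2`, `Cert : CertPred n` a predicate of `(s₀, s₁, u, N, v)` (`v` the box-value function `(k, m) ↦ (D^k P)(∑ mⱼyⱼ, ∏ αⱼ^{mⱼ})`, `boxValues`) satisfying `Specialisable Cert` (W2a: a certificate for `(V_{k,m}(ω))`, `ω` transcendental, `V_{k,m} ∈ ℚ[X]`, is one for `(V_{k,m}(0))`) and `RefutesSmall Cert` (W2b: no certificate for `(k, m) ↦ w_k ∈ ℚ` with `|w_k| ≤ e^{-N^u}` on `k ≤ N^{s₀}`); the statement attacked is `ExpFreeCertificateThesis n Cert` over Roy's box `deg_{X₀} ≤ N^{t₀}`, `deg_{X₁}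 ≤ N^{t₁}`, height `≤ e^N`, window `RoyAdmissible` [cite: Roy2001, §1 p. 183, criterion (Conj. 2) and window (1)]; instance: `cheapExactCert` (`cheapExactCert_specialisable`, `cheapExactCert_refutesSmall`) [folklore].
- blocks: every exp-free "for all points of `trdeg < n`" certificate thesis in Roy's window with a certificate notion in the class, for every `n ≥ 2` — in particular the route target `Summit.Schanuel.Schanuel.Theses.PolarPhantoms.PolarSchanuel` (R1, `not_expFreeCertificateThesis_cheapExactCert`) and any re-filing of it with extra hypotheses on the point that keep polynomial points `y = Y(ω)`, `α = A(ω)`, `Y(0) = 0`, `A(0) = 1` in scope (`not_frequently_cert_of_collapse`: `α` multiplicatively independent, `αⱼe^{-yⱼ} ∉ μ_∞`, no algebraic coordinate all keep the witness) [folklore].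
- because: at `yⱼ = ω^{j+1}`, `αⱼ = 1 + ω^{j+1}` (`ω = π` transcendental, `Literature.NumberTheory.Transcendental.transcendental_pi_holds`; `y` `ℚ`-free, `trdeg ℚ(y, α) = 1 < n`) every box value is `V_{k,m}(ω)` with `V_{k,m} ∈ ℚ[X]` and `V_{k,m}(0) = (D^k P)(0, 1)` independent of `m` — the place `X ↦ 0` collapses the multi-orbit `(m·y, α^m)` onto the exponential point `(0, e⁰)` — and Roy's unconditional auxiliary polynomials at `y' = 0` (`Literature.NumberTheory.Transcendental.royHypothesis_exp'`, every admissible parameter set, all large `N`) give a non-zero `P_N` in the box with `|(D^k P_N)(0, 1)| ≤ e^{-N^u}` for `k ≤ N^{s₀}` [cite: Roy2001, §5 (2°)]; (W2a) moves the certificate of `P_N` to `w_k = (D^k P_N)(0,1)`, (W2b) refutes it, so at this point NO admissible parameter set certifies all of the box for infinitely many `N` [folklore].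
- evasions_known: none published; in tree, the only certificate notion recorded outside the class is ARCHIMEDEAN (`archimedeanCert`: cheap complex `c` with `|∑ c v| ≥ 1`; it satisfies (W2b), `archimedeanCert_refutesSmall`, but not (W2a), `not_specialisable_archimedeanCert`), and its thesis is definitionally the `∃`-parameter contrapositive of Roy's criterion (`expFreeCertificateThesis_archimedeanCert_iff`, implied by `Literature.NumberTheory.Transcendental.RoyCriterion n`, `expFreeCertificateThesis_archimedeanCert_of_royCriterion`), i.e. route `RoyCriterion` itself, equivalent to Schanuel for rank `n` by the named fact `Literature.NumberTheory.Transcendental.Roy2001_iff` [cite: Roy2001, §1 p. 183 (equivalence of Conj. 1 and Conj. 2 for each l)]; restricting a thesis to exponential points `α = exp ∘ y` evades the witness but makes it the summit `Schanuel` for rank `n` (route glue `PolarGlue`) [folklore].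
- scope_caveats: the theorem concerns theses quantified over ALL points of `trdeg < n` with `y` `ℚ`-free and `αⱼ ≠ 0`, with Roy's box, Roy's `(k, m)`-range and the `∃ admissible parameters, ∃ᶠ N, ∀ P` quantifier pattern exactly as in `ExpFreeCertificateThesis`; it says nothing about certificate notions violating (W2a) or (W2b), about theses restricted to classes of points excluding every collapsing polynomial point (e.g. all coordinates algebraic, where `n ≥ 2` points of `trdeg < n` still exist), about `n = 1`, or about statements of the shape of R2 (`PhantomsAreTraceless`: `∀ᶠ N` over functionals on the monomial box), which is killed in tree by the different place `e ↦ 0` at `y = (1, e)`, `α = (e, 1)` and is not an instance of this schema [folklore].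
- status: established — theorem of this file (`specialisationCollapseBarrier_holds`) [cite: Roy2001, §5 (2°)]. -/
def SpecialisationCollapseBarrier : Prop :=
  ∀ n : ℕ, 2 ≤ n → ∀ Cert : CertPred n, Specialisable Cert → RefutesSmall Cert →
    ¬ ExpFreeCertificateThesis n Cert

/-- The catalogue declaration holds. [cite: Roy2001, §5 (2°)] -/
theorem specialisationCollapseBarrier_holds : SpecialisationCollapseBarrier :=
  fun _ hn _ hW2a hW2b => not_expFreeCertificateThesis_of_specialisable_of_refutesSmall hn hW2a hW2b

/-- Unfolding lemma for the catalogue declaration. [folklore] -/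
theorem specialisationCollapseBarrier_iff :
    SpecialisationCollapseBarrier ↔
      ∀ n : ℕ, 2 ≤ n → ∀ Cert : CertPred n, Specialisable Cert → RefutesSmall Cert →
        ¬ ExpFreeCertificateThesis n Cert :=
  Iff.rfl

end Literature.Barriers.Schanuel

end
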